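import Mathlib
import HarnessLib
import Summits.QuantumFields.YangMills.Theses.PencilRigidity
import Summits.QuantumFields.YangMills.Theorems.PencilRigidityCurvatureKernelBoundKernelPinning
import Summits.QuantumFields.YangMills.Theorems.HypercubicLimit.Negative.NonabelianLoadBearing
import Literature.Analysis.FunctionSpaces.TranslationInvariantDistribution

/-!
# `CurvatureKernelBound` — the degenerate (factorising) branch of the axial growth bound
(support for stmt-QuantumFields-11687)

Support file for crux `stmt-QuantumFields-11687` (`PencilRigidity.CurvatureKernelBound`), line
`sixteen-charts-analytic-kernel`, stub S2 `DegenerateAxialGrowth` (model-blind).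

**Statement.** Assume S1 (a continuous functional on two-point test functions vanishing on all real
off-diagonal tensors vanishes on `⁰𝒮₂`). Let `S₁` be a Schwinger family on `ℝ⁴` which is translation
invariant on `⁰𝒮` and whose two-point function FACTORISES on real off-diagonal tensors,
`S₁ 2 (f₀ ⊗ f₁) = S₁ 1 f₀ · S₁ 1 f₁`. Then every kernel `K` continuous off `0` representing `S₁ 2` on
`⁰𝒮₂` obeys the axial growth bound `‖K(s e₀)‖ ≤ C s^(η−10)` on `(0,1]` (with `η = 10`, `C = ‖κ²‖`).

**Route.** (1) In degree one every test function is off-diagonal (the coincidence locus of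
`Fin 1 → ℝ⁴` is empty: tree lemma `HypercubicLimit.Negative.isOffDiagonal_fin_one`), so `S₁ 1` is
translation invariant on all of `𝓢`; transported to `𝓢(ℝ⁴, ℂ)` along
`ContinuousLinearEquiv.funUnique : (Fin 1 → ℝ⁴) ≃L ℝ⁴` it is a translation-invariant tempered
distribution, hence `κ ∫` (`Literature…exists_eq_const_mul_integral_of_forall_compSubConstCLM`). (2) Factorisation and Fubini
give `S₁ 2 F = κ² ∫ F` on real off-diagonal tensors, and S1 applied to `S₁ 2 − κ² ∫` extends this to
all of `⁰𝒮₂`. (3) The constant kernel `κ²` therefore represents `S₁ 2` on `⁰𝒮₂` as well, so `K = κ²`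
off `0` by kernel uniqueness (`kernel_unique_of_realTensor`), and `‖K(s e₀)‖ = ‖κ²‖ = ‖κ²‖ s⁰`.
[StreaterWightman1964 §2-1; folklore]
-/

noncomputable section

open scoped BigOperators Topology SchwartzMap ComplexConjugate
open MeasureTheory Filter Set
open Literature.MathematicalPhysics.QuantumLattice Literature.MathematicalPhysics.AQFT

namespace Summit.QuantumFields.YangMills.Theorems.CurvatureKernel

namespace DegenerateAxial

/-! ## Degree one: every test function is off-diagonal, so `S₁ 1 = κ ∫` -/

/-- The coordinate isomorphism `coordOne := ContinuousLinearEquiv.funUnique (Fin 1) ℝ ℝ⁴ :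
(Fin 1 → ℝ⁴) ≃L[ℝ] ℝ⁴` is `x ↦ x 0`. [folklore] -/
theorem coordOne_apply (x : Fin 1 → EuclideanSpace ℝ (Fin 4)) :
    ContinuousLinearEquiv.funUnique (Fin 1) ℝ (EuclideanSpace ℝ (Fin 4)) x = x 0 := by
  rw [ContinuousLinearEquiv.coe_funUnique, Function.eval, Fin.default_eq_zero]

/-- Pulling back a translate along `coordOne` is the diagonal translate of the pull-back.
[folklore] -/
theorem comp_coordOne_compSubConstCLM (a : EuclideanSpace ℝ (Fin 4)) (u : 𝓢(EuclideanSpace ℝ (Fin 4), ℂ)) :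
    SchwartzMap.compCLMOfContinuousLinearEquiv ℂ
        (ContinuousLinearEquiv.funUnique (Fin 1) ℝ (EuclideanSpace ℝ (Fin 4))) (SchwartzMap.compSubConstCLM ℂ a u) =
      translateMulti a (SchwartzMap.compCLMOfContinuousLinearEquiv ℂ
        (ContinuousLinearEquiv.funUnique (Fin 1) ℝ (EuclideanSpace ℝ (Fin 4))) u) := by
  ext x
  rw [translateMulti_apply, SchwartzMap.compCLMOfContinuousLinearEquiv_apply,
    SchwartzMap.compCLMOfContinuousLinearEquiv_apply, Function.comp_apply, Function.comp_apply,
    SchwartzMap.compSubConstCLM_apply, coordOne_apply, coordOne_apply]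

/-- **Degree one is a constant multiple of Lebesgue measure on real one-point tensors.** If `S₁` is
translation invariant on `⁰𝒮` then there is `κ ∈ ℂ` with `S₁ 1 F₀ = κ ∫ f` for every `F₀` which is
the (one-fold) tensor of the real test function `f`. [StreaterWightman1964 §2-1; folklore] -/
theorem exists_degreeOne_eq_const_mul_integral (S₁ : SchwingerFamily (EuclideanSpace ℝ (Fin 4)))
    (htr : ∀ (n : ℕ) (a : EuclideanSpace ℝ (Fin 4)) (F : 𝓢((Fin n → EuclideanSpace ℝ (Fin 4)), ℂ)),
      IsOffDiagonal F → S₁ n (translateMulti a F) = S₁ n F) :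
    ∃ κ : ℂ, ∀ (f : 𝓢(EuclideanSpace ℝ (Fin 4), ℝ)) (F₀ : 𝓢((Fin 1 → EuclideanSpace ℝ (Fin 4)), ℂ)),
      IsTensorOf F₀ (fun _ => ofRealTest f) →
        S₁ 1 F₀ = κ * ∫ x : EuclideanSpace ℝ (Fin 4), (f x : ℂ) := by
  -- pull-back along `coordOne : (Fin 1 → ℝ⁴) ≃L[ℝ] ℝ⁴`
  let P : 𝓢(EuclideanSpace ℝ (Fin 4), ℂ) →L[ℂ] 𝓢((Fin 1 → EuclideanSpace ℝ (Fin 4)), ℂ) :=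
    SchwartzMap.compCLMOfContinuousLinearEquiv ℂ (ContinuousLinearEquiv.funUnique (Fin 1) ℝ (EuclideanSpace ℝ (Fin 4)))
  let T₁ : 𝓢(EuclideanSpace ℝ (Fin 4), ℂ) →L[ℂ] ℂ := (S₁ 1).comp P
  have hT₁ : ∀ (a : EuclideanSpace ℝ (Fin 4)) (u : 𝓢(EuclideanSpace ℝ (Fin 4), ℂ)),
      T₁ (SchwartzMap.compSubConstCLM ℂ a u) = T₁ u := by
    intro a u
    change S₁ 1 (P (SchwartzMap.compSubConstCLM ℂ a u)) = S₁ 1 (P u)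
    rw [comp_coordOne_compSubConstCLM, htr 1 a _ (HypercubicLimit.Negative.isOffDiagonal_fin_one _)]
  obtain ⟨κ, hκ⟩ :=
    Literature.Analysis.FunctionSpaces.exists_eq_const_mul_integral_of_forall_compSubConstCLM T₁ hT₁
  refine ⟨κ, fun f F₀ hF₀ => ?_⟩
  have hF : F₀ = P (ofRealTest f) := by
    ext x
    rw [hF₀ x, Fin.prod_univ_one, SchwartzMap.compCLMOfContinuousLinearEquiv_apply,
      Function.comp_apply, coordOne_apply]
  have h := hκ (ofRealTest f)
  rw [hF]
  exact h

/-! ## Degree two: `S₁ 2 = κ² ∫` on `⁰𝒮₂` -/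

/-- Lebesgue measure on `(ℝ⁴)²` has temperate growth (inference from `IsAddHaarMeasure` does not
fire on the `Pi` measure space by itself). [folklore] -/
theorem hasTemperateGrowth_volume_two :
    (volume : Measure (Fin 2 → EuclideanSpace ℝ (Fin 4))).HasTemperateGrowth :=
  Measure.IsAddHaarMeasure.instHasTemperateGrowth

/-- The integral of a real two-point tensor factorises: `∫ f₀ ⊗ f₁ = (∫ f₀) (∫ f₁)` (Fubini).
[folklore] -/
theorem integral_realTensor_two (f : Fin 2 → 𝓢(EuclideanSpace ℝ (Fin 4), ℝ))
    (F : 𝓢((Fin 2 → EuclideanSpace ℝ (Fin 4)), ℂ)) (hF : IsTensorOf F (fun i => ofRealTest (f i))) :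
    ∫ x : Fin 2 → EuclideanSpace ℝ (Fin 4), F x =
      (∫ x : EuclideanSpace ℝ (Fin 4), (f 0 x : ℂ)) * ∫ x : EuclideanSpace ℝ (Fin 4), (f 1 x : ℂ) := by
  have h1 : (F : (Fin 2 → EuclideanSpace ℝ (Fin 4)) → ℂ) =
      fun x => ∏ i, (fun (i : Fin 2) (y : EuclideanSpace ℝ (Fin 4)) => (f i y : ℂ)) i (x i) := by
    funext x
    rw [hF x]
    rfl
  rw [h1, integral_fintype_prod_volume_eq_prod (E := fun _ : Fin 2 => EuclideanSpace ℝ (Fin 4))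
    (fun (i : Fin 2) (y : EuclideanSpace ℝ (Fin 4)) => (f i y : ℂ)), Fin.prod_univ_two]

/-- **`S₁ 2 = κ² ∫` on `⁰𝒮₂`.** Under S1, translation invariance on `⁰𝒮` and factorisation on real
off-diagonal tensors, the two-point function is `κ²` times Lebesgue measure on every off-diagonal
test function. [folklore] -/
theorem twoPoint_eq_const_mul_integral
    (hS1 : ∀ (T : 𝓢((Fin 2 → EuclideanSpace ℝ (Fin 4)), ℂ) →L[ℂ] ℂ),
      (∀ (f : Fin 2 → 𝓢(EuclideanSpace ℝ (Fin 4), ℝ)) (F : 𝓢((Fin 2 → EuclideanSpace ℝ (Fin 4)), ℂ)),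
        IsTensorOf F (fun i => ofRealTest (f i)) → IsOffDiagonal F → T F = 0) →
      ∀ F : 𝓢((Fin 2 → EuclideanSpace ℝ (Fin 4)), ℂ), IsOffDiagonal F → T F = 0)
    (S₁ : SchwingerFamily (EuclideanSpace ℝ (Fin 4)))
    (htr : ∀ (n : ℕ) (a : EuclideanSpace ℝ (Fin 4)) (F : 𝓢((Fin n → EuclideanSpace ℝ (Fin 4)), ℂ)),
      IsOffDiagonal F → S₁ n (translateMulti a F) = S₁ n F)
    (hfac : ∀ (f : Fin 2 → 𝓢(EuclideanSpace ℝ (Fin 4), ℝ)) (F : 𝓢((Fin 2 → EuclideanSpace ℝ (Fin 4)), ℂ))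
      (F₀ F₁ : 𝓢((Fin 1 → EuclideanSpace ℝ (Fin 4)), ℂ)),
      IsTensorOf F (fun i => ofRealTest (f i)) → IsOffDiagonal F → IsTensorOf F₀ (fun _ => ofRealTest (f 0)) →
      IsTensorOf F₁ (fun _ => ofRealTest (f 1)) → S₁ 2 F = S₁ 1 F₀ * S₁ 1 F₁) :
    ∃ κ : ℂ, ∀ F : 𝓢((Fin 2 → EuclideanSpace ℝ (Fin 4)), ℂ), IsOffDiagonal F →
      S₁ 2 F = κ ^ 2 * ∫ x : Fin 2 → EuclideanSpace ℝ (Fin 4), F x := by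
  obtain ⟨κ, hκ⟩ := exists_degreeOne_eq_const_mul_integral S₁ htr
  refine ⟨κ, ?_⟩
  -- on real off-diagonal tensors
  have hreal : ∀ (f : Fin 2 → 𝓢(EuclideanSpace ℝ (Fin 4), ℝ)) (F : 𝓢((Fin 2 → EuclideanSpace ℝ (Fin 4)), ℂ)),
      IsTensorOf F (fun i => ofRealTest (f i)) → IsOffDiagonal F →
      S₁ 2 F = κ ^ 2 * ∫ x : Fin 2 → EuclideanSpace ℝ (Fin 4), F x := by
    intro f F hF hoff
    obtain ⟨F₀, hF₀⟩ := exists_isTensorOf (n := 1) (fun _ : Fin 1 => ofRealTest (f 0))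
    obtain ⟨F₁, hF₁⟩ := exists_isTensorOf (n := 1) (fun _ : Fin 1 => ofRealTest (f 1))
    rw [hfac f F F₀ F₁ hF hoff hF₀ hF₁, hκ (f 0) F₀ hF₀, hκ (f 1) F₁ hF₁, integral_realTensor_two f F hF]
    ring
  -- extension to `⁰𝒮₂` by S1
  haveI : (volume : Measure (Fin 2 → EuclideanSpace ℝ (Fin 4))).HasTemperateGrowth :=
    hasTemperateGrowth_volume_two
  let T : 𝓢((Fin 2 → EuclideanSpace ℝ (Fin 4)), ℂ) →L[ℂ] ℂ :=
    S₁ 2 - (κ ^ 2) • SchwartzMap.integralCLM ℂ (volume : Measure (Fin 2 → EuclideanSpace ℝ (Fin 4)))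
  have hT : ∀ F : 𝓢((Fin 2 → EuclideanSpace ℝ (Fin 4)), ℂ),
      T F = S₁ 2 F - κ ^ 2 * ∫ x : Fin 2 → EuclideanSpace ℝ (Fin 4), F x := by
    intro F
    simp only [T, sub_apply, smul_apply, SchwartzMap.integralCLM_apply, smul_eq_mul]
  intro F hoff
  have h0 : T F = 0 :=
    hS1 T (fun f G hG hGoff => by rw [hT, hreal f G hG hGoff, sub_self]) F hoff
  rw [hT] at h0
  exact sub_eq_zero.1 h0

end DegenerateAxial

open DegenerateAxial in
/-- **`DegenerateAxialGrowth`** (Stub S2 of line `sixteen-charts-analytic-kernel`, crux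
`PencilRigidity.CurvatureKernelBound`, registered signature verbatim): assuming S1, if `S₁` is
translation invariant on `⁰𝒮` and its two-point function factorises on real off-diagonal tensors,
then every kernel `K` continuous off `0` representing `S₁ 2` on `⁰𝒮₂` equals the constant `κ²` off the
origin (`S₁ 1 = κ ∫`), hence obeys the axial growth bound with `η = 10`, `C = ‖κ²‖`.
[StreaterWightman1964 §2-1; folklore] -/
theorem DegenerateAxialGrowth : open Literature.MathematicalPhysics.QuantumLattice Literature.MathematicalPhysics.AQFT Literature.MathematicalPhysics.QuantumFieldTheory in (∀ (T : SchwartzMap (Fin 2 → (EuclideanSpace ℝ (Fin 4))) ℂ →L[ℂ] ℂ), (∀ (f : Fin 2 → SchwartzMap (EuclideanSpace ℝ (Fin 4)) ℝ) (F : SchwartzMap (Fin 2 → (EuclideanSpace ℝ (Fin 4))) ℂ), IsTensorOf F (fun i => ofRealTest (f i)) → IsOffDiagonal F → T F = 0) → ∀ F : SchwartzMap (Fin 2 → (EuclideanSpace ℝ (Fin 4))) ℂ, IsOffDiagonal F → T F = 0) → ∀ (S₁ : SchwingerFamily (EuclideanSpace ℝ (Fin 4))), (∀ (n : ℕ) (a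 : (EuclideanSpace ℝ (Fin 4))) (F : SchwartzMap (Fin n → (EuclideanSpace ℝ (Fin 4))) ℂ), IsOffDiagonal F → S₁ n (translateMulti a F) = S₁ n F) → (∀ (f : Fin 2 → SchwartzMap (EuclideanSpace ℝ (Fin 4)) ℝ) (F : SchwartzMap (Fin 2 → (EuclideanSpace ℝ (Fin 4))) ℂ) (F₀ F₁ : SchwartzMap (Fin 1 → (EuclideanSpace ℝ (Fin 4))) ℂ), IsTensorOf F (fun i => ofRealTest (f i)) → IsOffDiagonal F → IsTensorOf F₀ (fun _ => ofRealTest (f 0)) → IsTensorOf F₁ (fun _ => ofRealTest (f 1)) → S₁ 2 F = S₁ 1 F₀ * S₁ 1 F₁) → ∀ (K : (EuclideanSpace ℝ (Fin 4)) → ℂ), ContinuousOn K {x : (EuclideanSpace ℝ (Fin 4)) | x ≠ 0} → (∀ F : SchwartzMap (Fin 2 → (EuclideanSpace ℝ (Fin 4))) ℂ, IsOffDiagonal F → MeasureTheory.Integrable (fun x : Fin 2 → (EuclideanSpace ℝ (Fin 4)) => K (x 0 - x 1) * F x) ∧ S₁ 2 F = ∫ x : Fin 2 → (EuclideanSpace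 ℝ (Fin 4)), K (x 0 - x 1) * F x) → ∃ C η : ℝ, 0 < η ∧ ∀ s : ℝ, 0 < s → s ≤ 1 → ‖K (EuclideanSpace.single 0 s)‖ ≤ C * s ^ (η - 10) := by
  intro hS1 S₁ htr hfac K hcont hrep
  obtain ⟨κ, hκ⟩ := twoPoint_eq_const_mul_integral hS1 S₁ htr hfac
  haveI : (volume : Measure (Fin 2 → EuclideanSpace ℝ (Fin 4))).HasTemperateGrowth :=
    hasTemperateGrowth_volume_two
  -- the constant kernel `κ²` also represents `S₁ 2` on `⁰𝒮₂`, hence `K = κ²` off `0`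
  have hKc : ∀ x : EuclideanSpace ℝ (Fin 4), x ≠ 0 → K x = κ ^ 2 := by
    refine kernel_unique_of_realTensor (K' := fun _ => κ ^ 2) hcont continuousOn_const ?_
    intro f F _ hoff _ _
    obtain ⟨hint, hSF⟩ := hrep F hoff
    refine ⟨hint, F.integrable.const_mul (κ ^ 2), ?_⟩
    rw [← hSF, hκ F hoff]
    exact (integral_const_mul _ _).symm
  refine ⟨‖κ ^ 2‖, 10, by norm_num, fun s hs _ => ?_⟩
  have hx : (EuclideanSpace.single (0 : Fin 4) s : EuclideanSpace ℝ (Fin 4)) ≠ 0 := by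
    intro h0
    have := congrArg (fun v : EuclideanSpace ℝ (Fin 4) => v 0) h0
    simp at this
    exact hs.ne' this
  rw [hKc _ hx, sub_self, Real.rpow_zero, mul_one]

end Summit.QuantumFields.YangMills.Theorems.CurvatureKernel

end
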